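import Summits.QuantumFields.BalabanUV.T4Continuum.Support.NE7SliceRepresentative
import Summits.QuantumFields.BalabanUV.T4Continuum.Support.NE7DecompOfDirectLettersSlice
import Summits.QuantumFields.BalabanUV.T4Continuum.Support.NE7RoutePiRegimeSU2
import Summits.QuantumFields.BalabanUV.T4Continuum.Support.AveragingDeficitMultiLevelBridge
import HarnessLib

/-!
# NE7HdecompOfDirectLetters — F4e: THE END's PER-PAIR BINDER `hdecomp♭` FROM THE TWO DIRECT LETTERS ALONE (memo ROAD-G102 §3∕§4): at `d = 4`, `L = 2`, for `0 < ε ≤ ε₂`, the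
# hypothesis `hdecomp♭` of `NE7HintOfSliceNormalisationSU2DecSlice.hint_SU2_of_decomposition` (for every admissible pair and every residual near-representative `u₀`: a unitary gauge `u`,
# `U′^{u} = U_s·e^{X}`, `X = X_T + X_N`, `X_T ∈ 𝒯_E(U_s)`, the ν- and κ-letters, `α·M ≤ α̂`, `ν ≤ ν̂`, `κ ≤ κ̂`) FOLLOWS from (S1) = `NE7SliceRepresentative.slice_representative` (the slice
# representative `u⋆`, THEOREM) and (S2) = the two DIRECT LETTERS (DL2)∕(DL1) for the coarse datum `φ(u⋆)` of the slice representative — displayed here as ONE hypothesis `hDL` over the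
# representative's data —, with the k-FREE ceilings `α̂ := C_S·ε`, `ν̂ := √(l2C∕(1−θ_ℓε)² + curl2C∕(1−θ_ℓε)²)·q₂`, `κ̂ := ε·(curl1C∕(1−θ_ℓε))·q₁` (junction `NE7DecompOfDirectLettersSlice.decomp_of_directLetters_coarse`)

Cell `pub-balaban`, rung (B)+1 sub-cell t4, lineage `b2b-balaban-t4-ne7-p1`, generation 102 (CRUX PROVER NE7 #1 = OWNER of BINDER row NE7).  Memo `t4/b2b-balaban-t4-ne7-p1-g102/ROAD-G102.md` §3.
WHAT ([folklore]; 0 def, 0 sorry).  **`hdecomp_of_directLetters`** (statement displayed): AFTER THIS FILE the supplier side of row NE7's END of record is EXACTLY the direct-letter hypothesis `hDL`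
((S2), memo §4) and the END's k-free numeric line.
HONEST FRAMING (page 1): bookkeeping over landed theorems; `hDL` is a HYPOTHESIS SHAPE asserted for nothing; nothing of Bałaban's asserted; NOT (S2), NOT NE7; spine 0∕9; finite T⁴ rung (B)+1 — NOT
infinite volume, NOT mass gap, NOT BetaPertH, NOT Clay.  Continuum YM on T⁴ ⇐ BetaPertH ∧ nine spine estimates (0/9 proved); BetaPertH ⇐ (D1) ∧ (D4) ∧ CAP+tail; G-an2-4 gates asym, D1 and NE2/3/4.
-/

set_option autoImplicit false

open scoped BigOperators Matrix Matrix.Norms.L2Operator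
open NormedSpace Finset Set

namespace Summit.QuantumFields.BalabanUV.T4Continuum.NE7HdecompOfDirectLetters

open Literature.MathematicalPhysics.QuantumFieldTheory.Balaban1983to89
open B7Prop1Explicit B7Prop2Explicit MatrixLog
open T4AveragingDeficitWall (IsUnitaryCfg IsSkewDir SmallField vary curl curlSq dirSq dirL1)
open T4AveragingDeficitWallBoundary (IsPeriodicCfg periodBox)
open AveragingDeficitPeriodicCounting (IsPeriodicDir)
open AveragingDeficitMultiLevelPrep (LevelSmall tower TangentIter cavgIter)
open AveragingDeficitMultiLevelBridge (cavgIter_eq_avgIter)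
open MinimalActionLevels (perWin)
open MinimalActionSandwich (admissible)
open MinimalActionRate (sfClass)
open NE3HessForm (dAction)
open NE3EnergyShapes (IsUnitarySite IsPeriodicSite)
open NE3EnergyWeightedShapes (energyNormW)
open NE3QbarIterCovLiftPrep (cruxC)
open NE3SmoothRightInverseW (rightInvW)
open NE3RightInverseSolveLetters (thetaLoc)
open NE3RightInverseL2Letter (l2C)
open NE3HatInvCurlLetters (curl2C curl1C)
open NE3LinearisedAverageSup (curvSum)
open NE3FramePotBoundW (tower_eq_pow_mul)
open BlockAverageVaryDisc (rho0)
open NE7MeanZeroGaugeSliceW (energyBlockLandauW)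
open NE7SliceIterationState (repLog cornerLog coarseDatum)
open NE7SliceIterationStateFacts (repLog_skew repLog_periodic coarseDatum_skew_periodic)
open NE7SliceRepresentative (slice_representative)
open NE7DecompOfDirectLettersSlice (decomp_of_directLetters_coarse)
open NE7RoutePiRegimeSU2 (thetaLoc_mul_lt_one)

noncomputable section

variable {n : Type*} [Fintype n] [DecidableEq n]

/-- **F4e — `hdecomp♭` FROM (S1) (THEOREM) AND (S2) (THE TWO DIRECT LETTERS, DISPLAYED)**, `d = 4`, `L = 2`: there are k-free `ε₂ > 0`, `C_S > 0` such that for every `0 < ε ≤ ε₂`, every `N`, and every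
`q₂ ≥ 0`, `q₁`: IF the direct letters (DL2) `dirSq φ(u) (periodBox N) ≤ q₂²·‖X(u)‖_w²` and (DL1) `dirL1 φ(u) (periodBox N) ≤ q₁·‖X(u)‖_w²` (`M^d∕M⁴ = 1`) hold for the coarse datum
`φ(u) = coarseDatum 2 k U_s U′ u` of EVERY slice representative `u` of an admissible-type pair (unitary `(tower)`-periodic `U_s`, `U′` at radius `ε∕M²` with the same `(k+1)`-fold average, the class
facts, `u` unitary `(tower)`-periodic with the chart `U′^{u} = U_s e^{X(u)}`, `M‖X(u)‖ ≤ C_S ε`, corners with `‖h(u)‖ ≤ C_S ε`, the line `4·51²·C_S·ε ≤ ρ₀²`, and `X(u) − rightInvW(φ(u)) ∈ 𝒯_E(U_s)`),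
THEN the END's binder `hdecomp♭` holds with `α̂ := C_S·ε`, `ν̂ := √(l2C 4 2∕(1 − thetaLoc 4 2·ε)² + curl2C 4 2∕(1 − thetaLoc 4 2·ε)²)·q₂`, `κ̂ := ε·(curl1C 4 2∕(1 − thetaLoc 4 2·ε))·q₁`. [folklore] -/
theorem hdecomp_of_directLetters [Nonempty n] :
    ∃ ε₂ : ℝ, 0 < ε₂ ∧ ∃ CS : ℝ, 0 < CS ∧ ∀ (N : ℕ) [NeZero N] (ε : ℝ), 0 < ε → ε ≤ ε₂ → ∀ (β q₂ q₁ : ℝ), 0 ≤ q₂ →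
      -- (S2): THE TWO DIRECT LETTERS for the coarse datum of every slice representative
      (∀ (k : ℕ) (Us U' : Site 4 → Fin 4 → (Matrix n n ℂ)ˣ) (u : Site 4 → (Matrix n n ℂ)ˣ),
        IsUnitaryCfg Us → IsPeriodicCfg Us ((tower 2 N (k + 1) : ℕ) : ℤ) → SmallField Us (ε / (((2 : ℕ) : ℝ) ^ (k + 1)) ^ 2) →
        IsUnitaryCfg U' → IsPeriodicCfg U' ((tower 2 N (k + 1) : ℕ) : ℤ) → SmallField U' (ε / (((2 : ℕ) : ℝ) ^ (k + 1)) ^ 2) →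
        cavgIter 2 (k + 1) U' = cavgIter 2 (k + 1) Us →
        LevelSmall 4 2 k (ε / (((2 : ℕ) : ℝ) ^ (k + 1)) ^ 2) → LevelSmall 4 2 (k + 1) (ε / (((2 : ℕ) : ℝ) ^ (k + 1)) ^ 2) →
        cruxC 4 2 * ((((2 : ℕ) : ℝ) ^ (k + 1)) ^ 2 * (ε / (((2 : ℕ) : ℝ) ^ (k + 1)) ^ 2)) < 1 → curvSum 4 2 (k + 1) (ε / (((2 : ℕ) : ℝ) ^ (k + 1)) ^ 2) ≤ 2 / 3 * (2 : ℕ) →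
        4 * (3 + 12 * ((4 : ℕ) : ℝ)) ^ 2 * ((2 : ℕ) : ℝ) ^ (k + 1) * (CS * ε / ((2 : ℕ) : ℝ) ^ (k + 1)) ≤ rho0 4 2 ^ 2 →
        IsUnitarySite u → IsPeriodicSite u ((tower 2 N (k + 1) : ℕ) : ℤ) → gaugeAct u U' = vary Us (repLog Us U' u) 1 →
        (∀ (y : Site 4) (κ : Fin 4), ((2 : ℕ) : ℝ) ^ (k + 1) * ‖repLog Us U' u y κ‖ ≤ CS * ε) →
        (∀ z : Site 4, ((u ((((2 : ℕ) : ℤ)) ^ (k + 1) • z) : (Matrix n n ℂ)ˣ) : Matrix n n ℂ) = exp (cornerLog 2 k u z)) → (∀ z : Site 4, ‖cornerLog 2 k u z‖ ≤ CS * ε) →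
        (∀ (hWu' : IsUnitaryCfg Us) (hx' : 0 ≤ ε / (((2 : ℕ) : ℝ) ^ (k + 1)) ^ 2) (hs' : LevelSmall 4 2 k (ε / (((2 : ℕ) : ℝ) ^ (k + 1)) ^ 2))
            (hWx' : SmallField Us (ε / (((2 : ℕ) : ℝ) ^ (k + 1)) ^ 2)) (hθ' : cruxC 4 2 * ((((2 : ℕ) : ℝ) ^ (k + 1)) ^ 2 * (ε / (((2 : ℕ) : ℝ) ^ (k + 1)) ^ 2)) < 1)
            (hφ : IsSkewDir (coarseDatum 2 k Us U' u)),
          (fun y μ => repLog Us U' u y μ - rightInvW (le_refl 2) k hWu' hx' hs' hWx' N hθ' hφ y μ) ∈ energyBlockLandauW (d := 4) (n := n) 2 N (k + 1) Us) →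
        (((2 : ℕ) : ℝ) ^ (k + 1)) ^ 4 / (((2 : ℕ) : ℝ) ^ (k + 1)) ^ 4 * dirSq (coarseDatum 2 k Us U' u) (periodBox (d := 4) N)
            ≤ q₂ ^ 2 * energyNormW 2 (k + 1) Us (repLog Us U' u) (periodBox (d := 4) (N * 2 ^ (k + 1))) ^ 2 ∧
          (((2 : ℕ) : ℝ) ^ (k + 1)) ^ 4 / (((2 : ℕ) : ℝ) ^ (k + 1)) ^ 4 * dirL1 (coarseDatum 2 k Us U' u) (periodBox (d := 4) N)
            ≤ q₁ * energyNormW 2 (k + 1) Us (repLog Us U' u) (periodBox (d := 4) (N * 2 ^ (k + 1))) ^ 2) →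
      -- CONCLUSION: the END's `hdecomp♭` with `α̂ := C_S ε`, `ν̂`, `κ̂` as displayed
      ∀ D : Site 4 → Fin 4 → (Matrix n n ℂ)ˣ, IsUnitaryCfg D → IsPeriodicCfg D (N : ℤ) → SmallField D (4 * (Real.exp β - 1)) → ∀ (k : ℕ),
        ∀ Us ∈ admissible (sfClass 4 2 N ε) 2 (k + 1) D, SmallField Us ((1 / ((2 : ℕ) : ℝ) ^ 2 * ε / 2) / (((2 : ℕ) : ℝ) ^ (k + 1)) ^ 2) →
        (∀ φ : Site 4 → Fin 4 → Matrix n n ℂ, IsSkewDir φ → IsPeriodicDir φ ((N * 2 ^ (k + 1) : ℕ) : ℤ) → TangentIter 2 k Us φ → dAction Us φ (perWin 4 (N * 2 ^ (k + 1))) = 0) →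
        ∀ U' ∈ admissible (sfClass 4 2 N ε) 2 (k + 1) D,
        ∀ u₀ : Site 4 → (Matrix n n ℂ)ˣ, IsUnitarySite u₀ → IsPeriodicSite u₀ ((N * 2 ^ (k + 1) : ℕ) : ℤ) → (∀ z : Site 4, u₀ (((2 ^ (k + 1) : ℕ) : ℤ) • z) = 1) →
          (∀ (x : Site 4) (μ : Fin 4), ‖(((Us x μ)⁻¹ * gaugeAct u₀ U' x μ : (Matrix n n ℂ)ˣ) : Matrix n n ℂ) - 1‖
            ≤ 10000000000000000000000000000000000 * (2 : ℝ) ^ (k + 1) * (ε / (((2 : ℕ) : ℝ) ^ (k + 1)) ^ 2)) →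
        ∃ (u : Site 4 → (Matrix n n ℂ)ˣ) (X XT XN : Site 4 → Fin 4 → Matrix n n ℂ) (α ν κ : ℝ),
          IsUnitarySite u ∧ IsSkewDir X ∧ IsPeriodicDir X ((N * 2 ^ (k + 1) : ℕ) : ℤ) ∧ 0 ≤ α ∧ (∀ x μ, ‖X x μ‖ ≤ α) ∧
          gaugeAct u U' = vary Us X 1 ∧
          X = XT + XN ∧ XT ∈ energyBlockLandauW (d := 4) (n := n) 2 N (k + 1) Us ∧ IsSkewDir XN ∧ 0 ≤ ν ∧
          energyNormW 2 (k + 1) Us XN (periodBox (d := 4) (N * 2 ^ (k + 1)))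
            ≤ ν * energyNormW 2 (k + 1) Us X (periodBox (d := 4) (N * 2 ^ (k + 1))) ∧
          ε / (((2 : ℕ) : ℝ) ^ (k + 1)) ^ 2 * (∑ p ∈ perWin 4 (N * 2 ^ (k + 1)), ‖curl Us XN p‖)
            ≤ κ * energyNormW 2 (k + 1) Us X (periodBox (d := 4) (N * 2 ^ (k + 1))) ^ 2 ∧
          α * ((2 : ℕ) : ℝ) ^ (k + 1) ≤ CS * ε ∧
          ν ≤ Real.sqrt (l2C 4 2 / (1 - thetaLoc 4 2 * ε) ^ 2 + curl2C 4 2 / (1 - thetaLoc 4 2 * ε) ^ 2) * q₂ ∧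
          κ ≤ ε * (curl1C 4 2 / (1 - thetaLoc 4 2 * ε)) * q₁ := by
  obtain ⟨ε₂, hε₂, CS, hCS, hrep⟩ := slice_representative (n := n) (d := 3) (by norm_num) (le_refl 2) (bh := 10000000000000000000000000000000000) (by norm_num)
  refine ⟨min ε₂ (min (1 / 10 ^ 53) (1 / (8 * CS + 8))), lt_min hε₂ (lt_min (by norm_num) (by positivity)), CS, hCS, ?_⟩
  intro N _ ε hε hεle β q₂ q₁ hq₂ hDL D _ _ _ k Us hUs _ _ U' hU' u₀ hu₀ hu₀P hpin hclose
  have hε₂' : ε ≤ ε₂ := hεle.trans (min_le_left _ _)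
  have hε53 : ε ≤ 1 / 10 ^ 53 := hεle.trans ((min_le_right _ _).trans (min_le_left _ _))
  have hεCS : ε ≤ 1 / (8 * CS + 8) := hεle.trans ((min_le_right _ _).trans (min_le_right _ _))
  have hε1 : ε ≤ 1 := hε53.trans (by norm_num)
  have hCSε : CS * ε ≤ 1 / 8 := by
    have h1 : CS * ε ≤ CS * (1 / (8 * CS + 8)) := mul_le_mul_of_nonneg_left hεCS hCS.le
    have h2 : CS * (1 / (8 * CS + 8)) ≤ 1 / 8 := by
      rw [mul_one_div, div_le_iff₀ (by positivity)]; nlinarith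
    exact h1.trans h2
  -- the pair's class data
  have hT : (tower 2 N (k + 1) : ℕ) = N * 2 ^ (k + 1) := by rw [tower_eq_pow_mul, Nat.mul_comm]
  obtain ⟨⟨hWu, hWP, hWx⟩, hWavg⟩ := hUs
  obtain ⟨⟨hU'u, hU'P, hU'x⟩, hU'avg⟩ := hU'
  have hWPt : IsPeriodicCfg Us ((tower 2 N (k + 1) : ℕ) : ℤ) := by rw [hT]; exact hWP
  have hU'Pt : IsPeriodicCfg U' ((tower 2 N (k + 1) : ℕ) : ℤ) := by rw [hT]; exact hU'P
  have htop : cavgIter 2 (k + 1) U' = cavgIter 2 (k + 1) Us := by rw [cavgIter_eq_avgIter, cavgIter_eq_avgIter, hU'avg, hWavg]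
  have hu₀Pt : IsPeriodicSite u₀ ((tower 2 N (k + 1) : ℕ) : ℤ) := by rw [hT]; exact hu₀P
  have hpin' : ∀ z : Site 4, u₀ ((((2 : ℕ) : ℤ)) ^ (k + 1) • z) = 1 := fun z => by
    have h := hpin z; rwa [Nat.cast_pow] at h
  have hclose' : ∀ (x : Site 4) (μ : Fin 4), ‖(((Us x μ)⁻¹ * gaugeAct u₀ U' x μ : (Matrix n n ℂ)ˣ) : Matrix n n ℂ) - 1‖
      ≤ 10000000000000000000000000000000000 * ((2 : ℕ) : ℝ) ^ (k + 1) * (ε / (((2 : ℕ) : ℝ) ^ (k + 1)) ^ 2) := fun x μ => by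
    have h := hclose x μ; rwa [show (2 : ℝ) = ((2 : ℕ) : ℝ) by norm_num] at h
  -- (S1): the slice representative
  obtain ⟨hsk, hsk1, hθ, hA, hρl, u, hu, huP, hgauge, hXM, hcorner, hh, hslice⟩ :=
    hrep k N Us U' ε hε hε₂' hWu hWPt hWx hU'u hU'Pt hU'x hu₀ hu₀Pt hpin' hclose'
  -- sizes of the representative
  have hM0 : (0 : ℝ) < ((2 : ℕ) : ℝ) ^ (k + 1) := by positivity
  have hM1 : (1 : ℝ) ≤ ((2 : ℕ) : ℝ) ^ (k + 1) := one_le_pow₀ (by norm_num)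
  have hx : 0 ≤ ε / (((2 : ℕ) : ℝ) ^ (k + 1)) ^ 2 := by positivity
  have hsup : ∀ (y : Site 4) (κ : Fin 4), ‖repLog Us U' u y κ‖ ≤ CS * ε / ((2 : ℕ) : ℝ) ^ (k + 1) := fun y κ => by
    rw [le_div_iff₀ hM0, mul_comm]; exact hXM y κ
  have hX8 : ∀ (y : Site 4) (κ : Fin 4), ‖repLog Us U' u y κ‖ ≤ 1 / 8 := fun y κ =>
    (hsup y κ).trans ((div_le_self (by positivity) hM1).trans hCSε)
  have hh8 : ∀ z : Site 4, ‖cornerLog 2 k u z‖ ≤ 1 / 8 := fun z => (hh z).trans hCSε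
  have hXs := repLog_skew hWu U' hU'u hu hgauge hX8
  have hXP : IsPeriodicDir (repLog Us U' u) ((N * 2 ^ (k + 1) : ℕ) : ℤ) := by rw [← hT]; exact repLog_periodic k N U' hWPt hU'Pt huP
  have hφ := (coarseDatum_skew_periodic (le_refl 2) k hWu hx hsk hWx N U' hWPt hU'u hU'Pt hu huP hgauge hX8 hcorner hh8).1
  -- (S2): the direct letters for this representative
  obtain ⟨hDL2, hDL1⟩ := hDL k Us U' u hWu hWPt hWx hU'u hU'Pt hU'x htop hsk hsk1 hθ hA hρl hu huP hgauge hXM hcorner hh hslice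
  -- the junction
  have hθl : thetaLoc 4 2 * ε < 1 := thetaLoc_mul_lt_one hε hε53
  obtain ⟨u', X, XT, XN, α, ν, κ, hu', hXs', hXP', hα, hXα, hg', hXdec, hXT, hXN, hν, hN1, hN2, hαeq, hνeq, hκeq⟩ :=
    decomp_of_directLetters_coarse (d := 4) (L := 2) (N := N) (le_refl 2) k hε hsk hθl hε1 (Us := Us) (U' := U') ⟨hWu, hWP, hWx⟩
      (fun j W => energyBlockLandauW (d := 4) (n := n) 2 N (j + 1) W) (fun Y hY => hY.1) hφ hq₂ hu hgauge hXs hXP (by positivity) hsup hslice hDL2 hDL1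
  refine ⟨u', X, XT, XN, α, ν, κ, hu', hXs', hXP', hα, hXα, hg', hXdec, hXT, hXN, hν, hN1, hN2, ?_, le_of_eq hνeq, le_of_eq hκeq⟩
  rw [hαeq]; exact le_of_eq (by field_simp)

end

end Summit.QuantumFields.BalabanUV.T4Continuum.NE7HdecompOfDirectLetters
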